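import Literature.AnabelianGeometry.EtaleTheta.SettingModelTateTheta
import HarnessLib

/-!
# The stage-2 model of the [EtTh] §1 root: why the record `modelχq p i j` asks for an EVEN shear exponent `j`
# (negative certificate at `N = 2`, proof-only companion of `SettingModelTateTheta`)

Mochizuki, *The étale theta function …*, Publ. RIMS **45** (2009) [EtTh], §1, PRIMS PDF p. 13–14
[cite: MochizukiEtTh2009, §1 p.14]: "`Π^tp_{Y_N}`" is the kernel of "`Π^tp_Y ↠ Gal(Y_N/Y)`", a quotient of
"`Gal(Y_N/X)`" — so `Π^tp_{Y_N}` is NORMAL in `Π^tp_X`. abc-iut cell, layer L2, R78 cluster STAGE 2, hand F5q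
(seat abc-iut-L2-t5 gen 6), sequel (s2) of `SettingModelTateTheta.lean`: there the root record
`ThetaSetting.modelχq p i j (hj : Even j)` carries the binder `Even j` because the covering subgroup
`Π^tp_{Y_N} := Δ^tp_{Y_N} ⋊ G_{K_N}` of `Γ ⋊_{actχq p i j} G_{ℚ_p}` (`K_N = ℚ_p(μ_N, (p²)^{1/N})`) is normal iff
`jκ_p ≡ 0 (N)` on `G_{K_N} = {χ_N = 1 ∧ 2κ_p ≡ 0 (N)}`. This file certifies in the kernel that the binder is
SHARP: at `N = 2` one has `G_{K_2} = G_{ℚ_p}` (`K_2 = ℚ_p(±1, ±p) = ℚ_p`), some `σ ∈ G_{ℚ_p}` moves `√p`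
(`κ_p(σ)` odd), and conjugating the element `(1, σ) ∈ Π^tp_{Y_2}` by the degree-one loop `(a, 1)` produces
`(a·σ(a)⁻¹, σ)`, whose level-2 `y`-coordinate is `−jκ_p(σ) ≡ 1 (2)` for odd `j` — not in `Δ^tp_{Y_2}`:

* `exists_apply_pRoot_two_ne` — some `σ ∈ G_{ℚ_p}` has `σ(√p) ≠ √p` (`v_p(p) = 1` is odd);
* `levelChar_two_eq_one`, `level_two_sq` — `χ_2 ≡ 1` and `κ² ≡ 0 (2)` identically, so `G_{K_2} = G_{ℚ_p}`
  (`fixingSubgroup_fieldKN_qModel_two_eq_top`);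
* **`not_normal_YNχq_two_of_odd`** — for odd `j`, `Π^tp_{Y_2} ⋊ G_{K_2}` is NOT normal in `Π^tp_X`;
* **`normal_YNχq_two_iff`** — `(YNχq p i j 2).Normal ↔ Even j` (with `YNχq_normal` of the parent file).

HONEST LABEL: semi-synthetic model bookkeeping (consistency evidence only); nothing of [EtTh] is asserted; nothing
here bears on [IUTchIII] Cor. 3.12. PROOF-ONLY (no definitions).
-/

noncomputable section

open Function

namespace Literature.AnabelianGeometry.EtaleTheta.SettingModel

open Literature.AnabelianGeometry.SemiGraphs

variable (p : ℕ) [Fact p.Prime] (i j : ℤ)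

/-! ### Level `2`: every cyclotomic character and every square is invisible -/

/-- In `ℤ/2` every product `a·b = 1` forces `a = 1`. [folklore] -/
private theorem zmod_two_eq_one_of_mul_eq_one {a b : ZMod 2} (h : a * b = 1) : a = 1 := by
  revert a b h; decide

/-- `χ_2 ≡ 1`: every automorphism of `Ẑ` has level-`2` character `1` (`(ℤ/2)^× = 1`).
[cite: MochizukiEtTh2009, §1 p.13] -/
theorem levelChar_two_eq_one (φ : MulAut ZH) : ZHatLevel.levelChar 2 φ = 1 :=
  zmod_two_eq_one_of_mul_eq_one (ZHatLevel.levelChar_mul_levelChar_inv 2 φ)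

/-- Squares vanish at level `2`: `level 2 (z²) = 1` for every `z ∈ Ẑ`. [cite: MochizukiEtTh2009, §1 p.13] -/
theorem level_two_sq (z : ZH) : ZHatLevel.level 2 (z ^ 2) = 1 := by
  rw [map_pow]
  generalize ZHatLevel.level 2 z = m
  have h : ∀ m : Multiplicative (ZMod 2), m ^ 2 = 1 := by decide
  exact h m

/-- For odd `j`, `level 2 (z^j) = level 2 z`. [cite: MochizukiEtTh2009, §1 p.13] -/
theorem level_two_zpow_of_odd {j : ℤ} (hj : Odd j) (z : ZH) : ZHatLevel.level 2 (z ^ j) = ZHatLevel.level 2 z := by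
  obtain ⟨m, rfl⟩ := hj
  rw [zpow_add, zpow_one, map_mul, zpow_mul, zpow_ofNat, map_zpow, level_two_sq, one_zpow, one_mul]

/-- **`G_{K_2} = G_{ℚ_p}`** at `q_X = p²` (`K_2 = ℚ_p(±1, ±p) = ℚ_p`), read through `mem_GKNq_iff`.
[cite: MochizukiEtTh2009, §1 p.13] -/
theorem fixingSubgroup_fieldKN_qModel_two_eq_top : (fieldKN ⊥ (qModel p) 2).fixingSubgroup = ⊤ := by
  refine eq_top_iff.mpr fun σ _ => ?_
  exact (mem_GKNq_iff p σ 2).mpr ⟨levelChar_two_eq_one _, level_two_sq _⟩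

/-! ### A Galois element moving `√p` -/

/-- `p` is not a square in `ℚ_p` (`v_p(p) = 1`). [folklore] -/
private theorem padic_sq_ne_p (x : ℚ_[p]) : x ^ 2 ≠ (p : ℚ_[p]) := by
  intro h
  have hp : (p : ℚ_[p]) ≠ 0 := Nat.cast_ne_zero.mpr (Fact.out : p.Prime).ne_zero
  have hx : x ≠ 0 := by
    rintro rfl
    exact hp (by rw [← h, zero_pow two_ne_zero])
  have hv := congrArg Padic.valuation h
  rw [Padic.valuation_pow, Padic.valuation_p] at hv
  omega

/-- **Some `σ ∈ G_{ℚ_p}` moves `√p = p^{1/2}`** (`√p ∉ ℚ_p`, and `ℚ_p` is the fixed field of `G_{ℚ_p}`); i.e.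
`κ_p(σ)` is odd. [cite: NeukirchANT1999, Ch. IV §3] -/
theorem exists_apply_pRoot_two_ne : ∃ σ : GQp p, σ (pRoot p 2) ≠ pRoot p 2 := by
  by_contra hall
  haveI : IsGalois ℚ_[p] (PadicAlgCl p) := {}
  have hmem : pRoot p 2 ∈ IntermediateField.fixedField (⊤ : Subgroup (GQp p)) := by
    rw [IntermediateField.mem_fixedField_iff]
    intro σ _
    by_contra hne
    exact hall ⟨σ, hne⟩
  rw [← IntermediateField.fixingSubgroup_bot, InfiniteGalois.fixedField_fixingSubgroup,
    IntermediateField.mem_bot] at hmem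
  obtain ⟨x, hx⟩ := hmem
  refine padic_sq_ne_p p x ((algebraMap ℚ_[p] (PadicAlgCl p)).injective ?_)
  have h2 : pRoot p 2 ^ (((2 : ℕ+) : ℕ)) = (p : PadicAlgCl p) := pRoot_pow p 2
  rw [map_pow, map_natCast, hx]
  exact h2

/-- Hence some `σ` has `κ_p(σ) ≢ 0 (2)`. [cite: NeukirchANT1999, Ch. IV §3] -/
theorem exists_level_two_kappaP_ne_one : ∃ σ : GQp p, ZHatLevel.level 2 (kappaP p σ) ≠ 1 := by
  obtain ⟨σ, hσ⟩ := exists_apply_pRoot_two_ne p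
  exact ⟨σ, fun h => hσ ((level_kappaP_eq_one_iff p σ 2).mp h)⟩

/-! ### The negative certificate -/

/-- The level-`2` image of the degree-one loop `a` of `Γ` is `(1, 0, 0)`. [cite: MochizukiEtTh2009, §1 p.12] -/
theorem levelHom_gfpOf_a (N : ℕ+) : levelHom N (gfpOf (FreeGroup.of 0)) = ⟨1, 0, 0⟩ := by
  rw [levelHom_gfpOf, heisHom_of_zero, Heis.map_apply]
  ext <;> simp

/-- **For odd `j`, `Π^tp_{Y_2} := Δ^tp_{Y_2} ⋊ G_{K_2}` is NOT normal in `Γ ⋊_{actχq p i j} G_{ℚ_p}`**: with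
`σ` moving `√p` and the loop `a`, the conjugate `(a,1)·(1,σ)·(a,1)⁻¹ = (a·σ(a)⁻¹, σ)` has level-`2`
`y`-coordinate `−jκ_p(σ) ≡ κ_p(σ) ≢ 0` — it leaves `Δ^tp_{Y_2} = {deg = 0, y ≡ 0}`. (Print's `Π^tp_{Y_N}` IS
normal, "`Gal(Y_N/X)`", p. 14 — so the stage-2 record must exclude odd `j`.) [cite: MochizukiEtTh2009, §1 p.14] -/
theorem not_normal_YNχq_two_of_odd (hj : Odd j) : ¬ (YNχq p i j 2).Normal := by
  intro hN
  obtain ⟨σ, hσ⟩ := exists_level_two_kappaP_ne_one p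
  have h1 : (SemidirectProduct.inr σ : PiTpχq p i j) ∈ YNχq p i j 2 := by
    refine (GfpTwistData₀.mem_YN _).mpr ⟨?_, ?_⟩
    · rw [SemidirectProduct.left_inr]
      exact Subgroup.one_mem _
    · rw [SemidirectProduct.right_inr, fixingSubgroup_fieldKN_qModel_two_eq_top]
      exact Subgroup.mem_top σ
  set γ : Gfp := gfpOf (FreeGroup.of 0) with hγ
  have h2 := hN.conj_mem _ h1 (SemidirectProduct.inl γ)
  have hleft : (SemidirectProduct.inl γ * SemidirectProduct.inr σ * (SemidirectProduct.inl γ)⁻¹ :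
      PiTpχq p i j).left = γ * (actχq p i j σ γ)⁻¹ := by
    simp [map_inv]
  have hdY := ((GfpTwistData₀.mem_YN _).mp h2).1
  rw [hleft] at hdY
  obtain ⟨-, hz⟩ := Subgroup.mem_inf.mp hdY
  obtain ⟨-, hy⟩ := Subgroup.mem_comap.mp hz
  have hy' : (levelHom 2 (γ * (actχq p i j σ γ)⁻¹)).y = 0 := hy
  rw [map_mul, map_inv, Heis.mul_y, Heis.inv_y, levelHom_actχq_y, hγ, levelHom_gfpOf_a] at hy'
  simp only [mul_zero, mul_one, zero_add] at hy'
  rw [level_two_zpow_of_odd hj, neg_eq_zero] at hy'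
  exact hσ (by rw [← ofAdd_toAdd (ZHatLevel.level 2 (kappaP p σ)), hy', ofAdd_zero])

/-- **`Π^tp_{Y_2} ⋊ G_{K_2}` is normal in the stage-2 `Π^tp_X` iff `j` is even** (the binder `Even j` of
`ThetaSetting.modelχq` is sharp). [cite: MochizukiEtTh2009, §1 p.14] -/
theorem normal_YNχq_two_iff : (YNχq p i j 2).Normal ↔ Even j :=
  ⟨fun h => by
    by_contra hne
    exact not_normal_YNχq_two_of_odd p i j (Int.not_even_iff_odd.mp hne) h,
    fun hj => YNχq_normal p i j hj 2⟩

end Literature.AnabelianGeometry.EtaleTheta.SettingModel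

end
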